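import Literature.AlgebraicGeometry.Pohlmann1968.CMFieldLowDegreeHodgeConjectureVariety
import HarnessLib

/-!
# EVERY abelian variety with complex multiplication by a CM field of degree `2p`, `p` prime — of ANY CM type — has `B•(Aⁿ) ⊗ ℂ = D•(Aⁿ) ⊗ ℂ` and
# satisfies the Hodge conjecture with all its powers

Layer `Literature/AlgebraicGeometry/Pohlmann1968`, namespace `Literature.AlgebraicGeometry.Pohlmann1968`; lane `lit-hodgefound` (Track 2 foundations
library), prover seat `lit-hodgefound-p10`, generation 33, row «A2-26(hp)» (self-proposed 2026-08-28).  Theorems only; no `def`, no instance, no named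
fact (net Literature debt 0).

`K` a CM field with `[K : ℚ] = 2p`, `p` prime (abelian varieties of PRIME dimension `p` with complex multiplication by `𝓞_K` through a type `Φ`).
PRIMITIVE `Φ`: nondegenerate by Yanai–Tankeev–Ribet (tree `isNondegenerate_of_isPrimitive_of_prime`; the tree's
`hodgeConjectureFor_pow_of_isPrimitive_of_prime` is this case).  NON-PRIMITIVE `Φ`: the primitive sub-pair `(K₁, Φ₁)` is a PROPER CM subfield
(`two_le_finrank_of_not_isPrimitive`), `[K₁ : ℚ] = 2 |Φ₁|` is even and `[K₁ : ℚ] · [K : K₁] = 2p` with `[K : K₁] ≥ 2`, so `[K₁ : ℚ] = 2`: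
`Φ` is induced from an imaginary quadratic field, `Φ₁` is nondegenerate (`isNondegenerate_of_finrank_eq_two`), and Hazama's criterion
(`IsNondegenerate.hodgeClassSpan_pow_eq_divisorClassesSpan_inducedCMType`) gives `B•(Aⁿ) = D•(Aⁿ)` (`A ∼ Eᵖ`, `E` a CM elliptic curve).

* **`finrank_eq_two_of_not_isPrimitive_of_finrank_eq_two_mul_prime`** (the sub-pair of a non-primitive type in degree `2p` is imaginary quadratic),
  **`hodgeClassSpan_pow_eq_divisorClassesSpan_of_finrank_eq_two_mul_prime`**, **`hodgeConjectureFor_pow_of_finrank_eq_two_mul_prime`** (the Hodge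
  conjecture for EVERY power of EVERY abelian variety of prime dimension `p` with complex multiplication by a CM field of degree `2p`, any type),
  `not_exists_exceptional_pow_of_finrank_eq_two_mul_prime`, `hodgeConjectureFor_of_finrank_eq_two_mul_prime` (`A` itself).

## References

* [Yanai1985] H. Yanai, *On degenerate CM-types*, J. Number Theory 21 (1985), §4 Theorem (p. 171) and Remark (p. 172).
* [Gordon1999HodgeAVSurvey] B. B. Gordon, *A survey of the Hodge conjecture for abelian varieties* (1999), Thm. 6.3 and Remark, Thm. 6.4, §9.3.
* [Hazama2003CyclicCM] F. Hazama, J. Math. Sci. Univ. Tokyo 10 (2003), p. 582.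
* [Streng2010] M. Streng, PhD thesis, Leiden (2010), Ch. I Lemma 3.5.
* [Shimura1998] G. Shimura (1998), §6.1 Thm. 2 (`2|Φ| = [K : ℚ]`), §6.2 Thm. 3, §8.2 Prop. 26.
-/

noncomputable section

open scoped Classical NumberField
open NumberField Module CategoryTheory CategoryTheory.Limits

namespace Literature.AlgebraicGeometry.Pohlmann1968

-- `open scoped`: the tree's action of `Aut(ℂ)` on `Hom(K, ℂ)` by composition (`ringEquivCompAction`) is a scoped instance
open scoped Literature.NumberTheory.ComplexMultiplication
open Literature.AlgebraicGeometry.Motives (CMType AbelianVariety)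
open Literature.AlgebraicGeometry.HodgeTheory
open Literature.AlgebraicGeometry.VanGeemen1994 (hodgeClassSpan)
open Literature.Barriers.HodgeConjecture (divisorClassesSpan)
open Literature.NumberTheory.ComplexMultiplication (IsPrimitive inducedCMType exists_primitive_inducedCMType_eq_of_isCMField)
open Literature.NumberTheory.ComplexMultiplication.CMTypeLattice (two_mul_card_eq_finrank)
open Literature.AlgebraicGeometry.ComplexMultiplication (IsCMTypeRealisation)

variable {K : Type} [Field K] [NumberField K] [IsCMField K] {p : ℕ}
  {A : AbelianVariety ℂ} {ι : 𝓞 K →+* End A} {θ : K →+* Module.End ℂ (complexBetti A.X 1)}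

omit [IsCMField K] in
/-- **IN DEGREE `2p` A NON-PRIMITIVE CM TYPE IS INDUCED FROM AN IMAGINARY QUADRATIC SUBFIELD**: its minimal sub-pair `(K₁, Φ₁)` has `[K₁ : ℚ] = 2`
(`[K₁ : ℚ] = 2|Φ₁|` is even, divides `2p`, and `[K : K₁] ≥ 2`). [cite: Shimura1998, §6.1 Thm. 2, §8.2 Prop. 26] [cite: Streng2010, Ch. I Lemma 3.5] -/
theorem finrank_eq_two_of_not_isPrimitive_of_finrank_eq_two_mul_prime (hp : p.Prime) (hK : Module.finrank ℚ K = 2 * p)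
    {Φ : CMType K} {K₁ : IntermediateField ℚ K} {Φ₁ : CMType K₁}
    (hmin : ∀ (K₂ : IntermediateField ℚ K) (Φ₂ : CMType K₂), inducedCMType (algebraMap K₂ K) Φ₂ = Φ →
      ∃ h : K₁ ≤ K₂, inducedCMType (IntermediateField.inclusion h : K₁ →+* K₂) Φ₁ = Φ₂)
    (φ₀ : K →+* ℂ) (hΦ : ¬ IsPrimitive (ℂ ≃+* ℂ) Φ.1 φ₀) : Module.finrank ℚ K₁ = 2 := by
  have h2 := two_le_finrank_of_not_isPrimitive hmin φ₀ hΦ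
  have hmul : Module.finrank ℚ K₁ * Module.finrank K₁ K = 2 * p := by rw [Module.finrank_mul_finrank ℚ K₁ K, hK]
  have hev : 2 * Fintype.card Φ₁.1 = Module.finrank ℚ K₁ := two_mul_card_eq_finrank Φ₁
  set c := Fintype.card Φ₁.1 with hc
  set e := Module.finrank K₁ K with he
  have hce : c * e = p := by
    have h : 2 * (c * e) = 2 * p := by rw [← hmul, ← hev]; ring
    omega
  have hcd : c ∣ p := ⟨e, hce.symm⟩
  rcases (Nat.dvd_prime hp).1 hcd with hc1 | hcp
  · omega
  · exfalso
    have : e = 1 := by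
      have h := hce
      rw [hcp] at h
      have hp0 := hp.pos
      nlinarith
    omega

/-- `Bᵐ ⊗ ℂ = Dᵐ ⊗ ℂ` for all `m` on an abelian variety gives the Hodge conjecture for it (Lefschetz `(1,1)`, cup products, tree theorems).
[cite: Gordon1999HodgeAVSurvey, §9.3] -/
private theorem hodgeConjectureFor_of_forall_hodgeClassSpan_eq₄₉ (B : AbelianVariety ℂ)
    (h : ∀ m : ℕ, hodgeClassSpan B.dim B.X m = divisorClassesSpan B.X B.dim m) : HodgeConjectureFor B.dim B.X :=
  ⟨nonempty_hodgeModel_holds (Motives.AbelianVariety.isSmoothProjective_holds (A := B)),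
    fun m _ hc hmm ↦ AbelianVariety.divisorClassesSpan_le_algebraicClasses B
      (fun b hb hb' ↦ lefschetzOneOne_rational_holds (Motives.AbelianVariety.isSmoothProjective_holds (A := B)) b hb hb') m
      ((h m) ▸ Submodule.subset_span ⟨hc, hmm⟩)⟩

/-- `A ∼ ⨁_{i<1} A`. [folklore] -/
private theorem isIsogenous_biproduct_fin_one₄₉ (B : AbelianVariety ℂ) :
    Motives.AbelianVariety.IsIsogenous B (⨁ fun _ : Fin 1 => B) :=
  let e : B ≅ ⨁ fun _ : Fin 1 => B := (biproductUniqueIso (fun _ : Fin 1 => B)).symm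
  ⟨e.hom, Motives.AbelianVariety.isIsogeny_hom_of_iso e⟩

/-- **`Bᵐ(Aⁿ) ⊗ ℂ = Dᵐ(Aⁿ) ⊗ ℂ` FOR ALL `n, m`, FOR EVERY CM TYPE OF EVERY CM FIELD OF DEGREE `2p` (`p` PRIME) AND EVERY REALISATION** — primitive:
Yanai–Tankeev–Ribet; non-primitive: induced from an imaginary quadratic subfield, Hazama's criterion. [cite: Yanai1985, §4 Theorem (p. 171)]
[cite: Gordon1999HodgeAVSurvey, Thm. 6.3, Thm. 6.4 and §9.3] [cite: Hazama2003CyclicCM, p. 582] -/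
theorem hodgeClassSpan_pow_eq_divisorClassesSpan_of_finrank_eq_two_mul_prime (hp : p.Prime) (hK : Module.finrank ℚ K = 2 * p)
    (Φ : CMType K) (hA : IsCMTypeRealisation Φ A ι θ) (n m : ℕ) :
    hodgeClassSpan (⨁ fun _ : Fin n => A).dim (⨁ fun _ : Fin n => A).X m =
      divisorClassesSpan (⨁ fun _ : Fin n => A).X (⨁ fun _ : Fin n => A).dim m := by
  obtain ⟨φ₀⟩ : Nonempty (K →+* ℂ) := inferInstance
  by_cases hΦ : IsPrimitive (ℂ ≃+* ℂ) Φ.1 φ₀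
  · exact (isNondegenerate_of_isPrimitive_of_prime hp hK φ₀ hΦ).hodgeClassSpan_pow_eq_divisorClassesSpan hA n m
  obtain ⟨K₁, Φ₁, hCM, h₁, -, hmin⟩ := exists_primitive_inducedCMType_eq_of_isCMField Φ
  haveI := hCM
  have hK₁ := finrank_eq_two_of_not_isPrimitive_of_finrank_eq_two_mul_prime hp hK hmin φ₀ hΦ
  exact (isNondegenerate_of_finrank_eq_two Φ₁ hK₁).hodgeClassSpan_pow_eq_divisorClassesSpan_inducedCMType h₁ hA n m

/-- **THE HODGE CONJECTURE FOR EVERY POWER OF EVERY ABELIAN VARIETY OF PRIME DIMENSION `p` WITH COMPLEX MULTIPLICATION BY A CM FIELD OF DEGREE `2p`**,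
any CM type, UNCONDITIONALLY. [cite: Yanai1985, §4 Theorem (p. 171) and Remark (p. 172)] [cite: Gordon1999HodgeAVSurvey, Thm. 6.3, Thm. 6.4 and §9.3] -/
theorem hodgeConjectureFor_pow_of_finrank_eq_two_mul_prime (hp : p.Prime) (hK : Module.finrank ℚ K = 2 * p) (Φ : CMType K)
    (hA : IsCMTypeRealisation Φ A ι θ) (n : ℕ) :
    HodgeConjectureFor (⨁ fun _ : Fin n => A).dim (⨁ fun _ : Fin n => A).X :=
  hodgeConjectureFor_of_forall_hodgeClassSpan_eq₄₉ _
    (fun m ↦ hodgeClassSpan_pow_eq_divisorClassesSpan_of_finrank_eq_two_mul_prime hp hK Φ hA n m)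

/-- No power of such an `A` carries an exceptional Hodge class. [cite: Gordon1999HodgeAVSurvey, Thm. 6.4] [cite: Yanai1985, Remark (p. 172)] -/
theorem not_exists_exceptional_pow_of_finrank_eq_two_mul_prime (hp : p.Prime) (hK : Module.finrank ℚ K = 2 * p) (Φ : CMType K)
    (hA : IsCMTypeRealisation Φ A ι θ) (n m : ℕ) :
    ¬ ∃ c : complexBetti (⨁ fun _ : Fin n => A).X (2 * m), IsRationalClass c ∧
        IsOfHodgeType (⨁ fun _ : Fin n => A).dim (⨁ fun _ : Fin n => A).X (2 * m) m m c ∧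
        c ∉ divisorClassesSpan (⨁ fun _ : Fin n => A).X (⨁ fun _ : Fin n => A).dim m := by
  rintro ⟨c, hcQ, hcH, hcD⟩
  exact hcD ((hodgeClassSpan_pow_eq_divisorClassesSpan_of_finrank_eq_two_mul_prime hp hK Φ hA n m) ▸ Submodule.subset_span ⟨hcQ, hcH⟩)

/-- **The Hodge conjecture for the variety itself** (spelling `A.dim`; `dim A = p`). [cite: Yanai1985, Remark (p. 172)]
[cite: Gordon1999HodgeAVSurvey, Thm. 6.3 and §9.3] -/
theorem hodgeConjectureFor_of_finrank_eq_two_mul_prime (hp : p.Prime) (hK : Module.finrank ℚ K = 2 * p) (Φ : CMType K)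
    (hA : IsCMTypeRealisation Φ A ι θ) : A.dim = p ∧ HodgeConjectureFor A.dim A.X := by
  refine ⟨?_, HodgeConjectureFor.of_isIsogenous (isIsogenous_biproduct_fin_one₄₉ A)
    (hodgeConjectureFor_pow_of_finrank_eq_two_mul_prime hp hK Φ hA 1)⟩
  have hd : A.dim = Module.finrank ℚ K / 2 := Motives.schemeDim_eq_holds hA.1
  rw [hd, hK]
  omega

end Literature.AlgebraicGeometry.Pohlmann1968

end
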